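import Summits.HodgeConjecture.HodgeConjecture.Theses.TorelliForSymmetries
import Literature.AlgebraicGeometry.Motives.HodgeClassesBoundedNormFinite
import Literature.AlgebraicGeometry.Motives.CorrespondencesAlgebraicOperators
import Literature.AlgebraicGeometry.Motives.StandardConjecturesKunnethProofs
import HarnessLib

/-!
# Route `TorelliForSymmetries`, support `ReflectionsDecide` (stmt-HodgeConjecture-11028):
# the reflection lemma

For a Betti–Hodge realization datum `B`, `X` smooth projective of dimension `n`, a codimension `p`
and a polarization `P` of the `ℚ`-Hodge structure `H²ᵖ_B(X)`: if for every Hodge class `v` the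
`P`-reflection `s_v : x ↦ x - (2 / P(v,v)) · P(x,v) · v` of `H²ᵖ_B(X)` is induced by a rational
algebraic correspondence on `X × X`, then `Hdgᵖ_B(X) = ℚ · Aᵖ_B(X)` (`B.HodgeConjectureFor hX p`).

## Proof (elementary, on the axioms of `WeilCohomology` / `BettiHodgeData`)

* Above the dimension (`n < p`) `H²ᵖ = 0` (`subsingleton_obj`).
* For `p ≤ n` there is a NON-ZERO rational algebraic class `e ∈ Aᵖ(X)_ℚ`
  (`exists_mem_ratAlgebraicClasses_ne_zero`): `e = 1` for `p = 0` (`1 ≠ 0` because `1 ∪ y = y` and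
  the trace `H²ⁿ → ℚ` is onto), `e = ηᵖ` for a hyperplane class `η` when `1 ≤ p ≤ n`
  (`pow_mem_ratAlgebraicClasses_of_isHyperplaneClass`; `ηᵖ ≠ 0` since `ηⁿ = ηᵖ ∪ η ∪ ⋯ ∪ η` has
  trace `deg X > 0`, `trace_pow_of_isHyperplaneClass`). It is a Hodge class
  (`algebraicClasses_le_hodgeClasses`).
* Algebraic correspondences preserve rational algebraic classes
  (`map_ratAlgebraicClasses_of_isInducedBy`), so `s_v(e) = e - (P(e,v) · 2/P(v,v)) v ∈ Aᵖ(X)_ℚ`,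
  hence `(P(e,v) · 2/P(v,v)) v ∈ ℚ · Aᵖ(X)`; if `P(e,v) ≠ 0` this gives `v ∈ ℚ · Aᵖ(X)` (for `v ≠ 0`,
  `P(v,v) > 0` by `Polarization.form_self_pos_of_mem_hodgeClasses`); if `P(e,v) = 0`, apply the
  previous case to the Hodge class `v + e`: `P(e, v + e) = P(e,e) > 0`.
-/

set_option linter.dupNamespace false

noncomputable section

namespace Summit.HodgeConjecture.HodgeConjecture.Theorems

open CategoryTheory MonoidalCategory
open Literature.AlgebraicGeometry.Motives

/-- **A non-zero rational algebraic class in every even degree `2p ≤ 2 dim X`** (Weil cohomology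
with `ℚ`-coefficients): the unit for `p = 0` (non-zero since `1 ∪ y = y` and the trace is onto),
the power `ηᵖ` of a hyperplane class for `1 ≤ p ≤ n` (non-zero since `tr(ηⁿ) = deg X > 0`).
[cite: Kleiman1968AlgebraicCycles, §1.2 (A), (C) and §1.4] -/
theorem exists_mem_ratAlgebraicClasses_ne_zero (W : WeilCohomology ℂ ℚ) {n : ℕ} {X : SchemeOver ℂ}
    (hX : IsSmoothProjective n X) {p : ℕ} (hp : p ≤ n) :
    ∃ e ∈ W.ratAlgebraicClasses X p, e ≠ 0 := by
  rcases Nat.eq_zero_or_pos p with rfl | hp1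
  · refine ⟨W.one X, W.one_mem_ratAlgebraicClasses hX, fun h0 ↦ ?_⟩
    obtain ⟨y, hy⟩ := (W.bijective_trace hX).2 1
    have hy0 : y = 0 := by
      have h := W.one_cup hX (show 0 + 2 * n = 2 * n by omega) y
      rw [h0, map_zero, LinearMap.zero_apply] at h
      exact h.symm
    rw [hy0, map_zero] at hy
    exact zero_ne_one hy
  · have hn : 1 ≤ n := le_trans hp1 hp
    obtain ⟨η, hη⟩ := W.isHyperplaneClass_nonempty hX hn
    obtain ⟨d, hd, htr⟩ := W.trace_pow_of_isHyperplaneClass hX η hη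
    have key : ∀ r s : ℕ, W.pow X η r = 0 → W.pow X η (r + s) = 0 := by
      intro r s h
      induction s with
      | zero => simpa using h
      | succ s ih =>
        rw [← add_assoc, W.pow_succ, ih, map_zero, LinearMap.zero_apply]
    refine ⟨W.pow X η p, W.pow_mem_ratAlgebraicClasses_of_isHyperplaneClass hX hη hp1, fun h0 ↦ ?_⟩
    have hn0 := key p (n - p) h0
    rw [Nat.add_sub_cancel' hp] at hn0
    rw [hn0, map_zero] at htr
    exact (Nat.cast_pos.mpr hd).ne' (α := ℚ) htr.symm

/-- **The reflection lemma** (support item `ReflectionsDecide` of route `TorelliForSymmetries`,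
stmt-HodgeConjecture-11028): if every `P`-reflection in a Hodge class of `H²ᵖ_B(X)` is induced by a
rational algebraic correspondence on `X × X`, then `Hdgᵖ_B(X) = ℚ · Aᵖ_B(X)`. See the module
docstring for the argument (Hodge–Riemann positivity on `(p,p)`-classes, a non-zero algebraic class
`ηᵖ`, and "algebraic correspondences preserve algebraic classes").
[cite: VoisinHodgeI2002, §7.1.2 Def. 7.7 and §11.3] [cite: Kleiman1968AlgebraicCycles, §1.3–1.4] -/
theorem torelliForSymmetries_reflectionsDecide_proof :
    Summit.HodgeConjecture.HodgeConjecture.Theses.TorelliForSymmetries.ReflectionsDecide := by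
  intro B n X hX p P hrefl
  rw [BettiHodgeData.hodgeConjectureFor_iff]
  -- `Aᵖ(X)_ℚ ⊆ ℚ · Aᵖ(X)` and `ℚ · Aᵖ(X) ⊆ Hdgᵖ(X)`
  have hrat : ∀ x, x ∈ B.W.ratAlgebraicClasses X p → x ∈ B.W.algebraicClasses X p :=
    fun x hx ↦ B.W.ratAlgebraicClasses_le_algebraicClasses X p hx
  by_cases hpn : n < p
  · -- above the dimension `H²ᵖ = 0`
    intro v _
    haveI := B.W.subsingleton_obj hX (show 2 * n < 2 * p by omega)
    rw [Subsingleton.elim v 0]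
    exact Submodule.zero_mem _
  have hp : p ≤ n := Nat.le_of_not_lt hpn
  have hpp : (p : ℤ) + p = ((2 * p : ℕ) : ℤ) := by push_cast; ring
  -- a non-zero algebraic Hodge class `e`
  obtain ⟨e, he, he0⟩ := exists_mem_ratAlgebraicClasses_ne_zero B.W hX hp
  have heA : e ∈ B.W.algebraicClasses X p := hrat e he
  have heH : e ∈ (B.hodge hX (2 * p)).hodgeClasses (p : ℤ) :=
    B.algebraicClasses_le_hodgeClasses hX p heA
  -- the reflection in a Hodge class `v` sends `e` into `Aᵖ(X)_ℚ`
  have hsv : ∀ v ∈ (B.hodge hX (2 * p)).hodgeClasses (p : ℤ),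
      (P.form e v * (2 / P.form v v)) • v ∈ B.W.algebraicClasses X p := by
    intro v hv
    obtain ⟨u, hu, hind⟩ := hrefl v hv (2 * n - 2 * p) (by omega)
    have hse : (LinearMap.id - (P.form.flip v).smulRight ((2 / P.form v v) • v) :
        B.W.obj X (2 * p) →ₗ[ℚ] B.W.obj X (2 * p)) e ∈ B.W.ratAlgebraicClasses X p :=
      B.W.map_ratAlgebraicClasses_of_isInducedBy hX hX u _ (by omega)
        (show 2 * p + 2 * n + (2 * n - 2 * p) = 2 * (n + n) by omega) hu hind e he
    have hse' := hrat _ hse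
    simp only [LinearMap.sub_apply, LinearMap.id_apply, LinearMap.smulRight_apply,
      smul_smul] at hse'
    have h := Submodule.sub_mem _ heA hse'
    rwa [sub_sub_cancel] at h
  -- conclusion for `v` with `P(e, v) ≠ 0`
  have hcase : ∀ v ∈ (B.hodge hX (2 * p)).hodgeClasses (p : ℤ), P.form e v ≠ 0 →
      v ∈ B.W.algebraicClasses X p := by
    intro v hv hev
    by_cases hv0 : v = 0
    · rw [hv0]; exact Submodule.zero_mem _
    have hvv : 0 < P.form v v := P.form_self_pos_of_mem_hodgeClasses hpp hv hv0
    have hc : P.form e v * (2 / P.form v v) ≠ 0 :=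
      mul_ne_zero hev (div_ne_zero two_ne_zero hvv.ne')
    have h := Submodule.smul_mem _ (P.form e v * (2 / P.form v v))⁻¹ (hsv v hv)
    rwa [smul_smul, inv_mul_cancel₀ hc, one_smul] at h
  intro v hv
  by_cases hev : P.form e v = 0
  · -- replace `v` by `v + e`
    have hve : v + e ∈ (B.hodge hX (2 * p)).hodgeClasses (p : ℤ) := Submodule.add_mem _ hv heH
    have hee : 0 < P.form e e := P.form_self_pos_of_mem_hodgeClasses hpp heH he0
    have hne : P.form e (v + e) ≠ 0 := by
      rw [map_add, hev, zero_add]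
      exact hee.ne'
    have h := Submodule.sub_mem _ (hcase (v + e) hve hne) heA
    rwa [add_sub_cancel_right] at h
  · exact hcase v hv hev

end Summit.HodgeConjecture.HodgeConjecture.Theorems

end
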